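import Literature.AlgebraicGeometry.ModuliOfAbelianVarieties.SiegelComplexRecordSystem
import Literature.NumberTheory.Automorphic.GLnAdelicStructure
import HarnessLib

/-!
# The principal levels `K_δ(N) ≤ GSp_δ(𝔸_{ℚ,f})` are open (and closed) for `N ≥ 1`

Topic `AlgebraicGeometry/ModuliOfAbelianVarieties`; namespace `Literature.AlgebraicGeometry.ModuliOfAbelianVarieties`.
Theorems only; no definition, no named fact, no instance, nothing asserted (net debt 0).  Layer (g-a4), first half, of
the I-1′ receptacle (cell hodgecm-mathlib, B-plan2 RECEPTACLE-PLAN §7.5 Δ1 «`isOpen_auxLevel` … preimage of an open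
subgroup under a continuous hom»): the openness of the tree's ★ `principalLevelSubgroup δ N`
(`= {γ ∈ GSp_δ(𝔸_f) | γ ≡ 1, γ⁻¹ ≡ 1 (mod N·𝓞̂)}`, ★ `SiegelComplexRecordSystem`) in `GSp_δ(𝔸_{ℚ,f}) =` ★ `gspFinAdelic δ`
with its subspace topology from `GL_{2g}(𝔸_{ℚ,f})` (Mathlib's units topology).

* `isOpen_integralAdeles` — `𝓞̂_K = ∏_v 𝓞_v` (FLT's ★ `FiniteAdeleRing.integralAdeles`, the spelling used by ★ `levelIdeal`)
  is open in `𝔸_{K,f}`: it has the same carrier as the tree's ★ `Automorphic.integralFiniteAdeles K`, open by ★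
  `Automorphic.isOpen_integralFiniteAdeles` (Mathlib `RestrictedProduct.isOpen_forall_mem`).
* `isUnit_natCast_finAdeleQ`, `mem_levelIdeal_iff_inv_mul_mem`, **`isOpen_levelIdeal`** (`N ≠ 0`): `N·𝓞̂` is the
  preimage of `𝓞̂` under the homeomorphism `x ↦ N⁻¹x` of `𝔸_{ℚ,f}`; `isClosed_levelIdeal`.
* **`isOpen_setOf_isCongOne`**: `{A ∈ M_n(𝔸_{ℚ,f}) | A ≡ 1 (mod N)}` is open (finitely many entry conditions).
* **`isOpen_principalLevelSubgroup δ (hN : N ≠ 0)`**, `isClosed_principalLevelSubgroup` (an open subgroup is closed).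

For `N = 0` the statements are false (`levelIdeal 0 = {0}`), whence the hypothesis `N ≠ 0`.

## References
* [Deligne1971TravauxShimura] P. Deligne, *Travaux de Shimura*, Sém. Bourbaki 389 (1971), Exemple 4.16 p. 150
  («`K(N) = {g ∈ CSp(V̂_ℤ) | g ≡ 1 mod N}`», a compact OPEN subgroup), 1.8 p. 129.
* [CasselsFrohlichANT1967] Cassels–Fröhlich, *Algebraic Number Theory*, Ch. II §14 (the restricted-product topology:
  `∏_v 𝓞_v` is open in `𝔸_{K,f}`).
* [PlatonovRapinchuk1994] Platonov–Rapinchuk, *Algebraic groups and number theory*, Ch. 5 §5.1 (congruence subgroups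
  of adelic groups are open).
-/

set_option autoImplicit false

noncomputable section

open Matrix NumberField IsDedekindDomain
open _root_.Topology

namespace Literature.AlgebraicGeometry.ModuliOfAbelianVarieties

variable {g : ℕ}

/-! ### §1. `𝓞̂` and `N·𝓞̂` are open in `𝔸_{ℚ,f}` -/

section Ideal

/-- **`𝓞̂_K = ∏_v 𝓞_v` is open in `𝔸_{K,f}`** (FLT's `FiniteAdeleRing.integralAdeles`, = the range of the structure map
`∏_v 𝓞_v → Πʳ_v [K_v, 𝓞_v]`; same carrier as the tree's `Automorphic.integralFiniteAdeles K`).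
[cite: CasselsFrohlichANT1967, Ch. II §14 (restricted topological product)] -/
theorem isOpen_integralAdeles (K : Type) [Field K] [NumberField K] :
    IsOpen (FiniteAdeleRing.integralAdeles (𝓞 K) K : Set (FiniteAdeleRing (𝓞 K) K)) := by
  have h : (FiniteAdeleRing.integralAdeles (𝓞 K) K : Set (FiniteAdeleRing (𝓞 K) K)) =
      (Literature.NumberTheory.Automorphic.integralFiniteAdeles K : Set (FiniteAdeleRing (𝓞 K) K)) := by
    rw [Literature.NumberTheory.Automorphic.coe_integralFiniteAdeles_eq_range_structureMap]
    rfl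
  rw [h]
  exact Literature.NumberTheory.Automorphic.isOpen_integralFiniteAdeles K

/-- A nonzero natural number is a unit of `𝔸_{ℚ,f}` (it is the image of a nonzero rational).
[cite: Deligne1971TravauxShimura, 0.4 p. 126] -/
theorem isUnit_natCast_finAdeleQ {N : ℕ} (hN : N ≠ 0) : IsUnit (N : finAdeleQ) := by
  have h : (N : finAdeleQ) = algebraMap ℚ finAdeleQ (N : ℚ) := (map_natCast (algebraMap ℚ finAdeleQ) N).symm
  rw [h]
  exact (Ne.isUnit (Nat.cast_ne_zero.2 hN : (N : ℚ) ≠ 0)).map (algebraMap ℚ finAdeleQ)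

/-- For `N ≠ 0`: `x ∈ N·𝓞̂ ↔ N⁻¹·x ∈ 𝓞̂`. [cite: Deligne1971TravauxShimura, Exemple 4.16 p. 150] -/
theorem mem_levelIdeal_iff_inv_mul_mem {N : ℕ} (hN : N ≠ 0) (x : finAdeleQ) :
    x ∈ levelIdeal N ↔
      (((isUnit_natCast_finAdeleQ hN).unit⁻¹ : finAdeleQˣ) : finAdeleQ) * x ∈ FiniteAdeleRing.integralAdeles (𝓞 ℚ) ℚ := by
  rw [mem_levelIdeal_iff]
  constructor
  · rintro ⟨y, hy, rfl⟩
    rwa [← mul_assoc, IsUnit.val_inv_mul, one_mul]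
  · intro h
    exact ⟨_, h, by rw [← mul_assoc, IsUnit.mul_val_inv, one_mul]⟩

/-- **`N·𝓞̂` is open in `𝔸_{ℚ,f}` for `N ≠ 0`** (the preimage of the open `𝓞̂` under the continuous `x ↦ N⁻¹x`).
[cite: Deligne1971TravauxShimura, Exemple 4.16 p. 150] [cite: CasselsFrohlichANT1967, Ch. II §14] -/
theorem isOpen_levelIdeal {N : ℕ} (hN : N ≠ 0) : IsOpen (levelIdeal N : Set finAdeleQ) := by
  have h : (levelIdeal N : Set finAdeleQ) =
      (fun x : finAdeleQ => (((isUnit_natCast_finAdeleQ hN).unit⁻¹ : finAdeleQˣ) : finAdeleQ) * x) ⁻¹'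
        (FiniteAdeleRing.integralAdeles (𝓞 ℚ) ℚ : Set finAdeleQ) := by
    ext x
    exact mem_levelIdeal_iff_inv_mul_mem hN x
  rw [h]
  exact (isOpen_integralAdeles ℚ).preimage (continuous_const.mul continuous_id)

/-- `N·𝓞̂` is closed in `𝔸_{ℚ,f}` for `N ≠ 0` (an open additive subgroup is closed). [cite: CasselsFrohlichANT1967, Ch. II §14] -/
theorem isClosed_levelIdeal {N : ℕ} (hN : N ≠ 0) : IsClosed (levelIdeal N : Set finAdeleQ) :=
  AddSubgroup.isClosed_of_isOpen _ (isOpen_levelIdeal hN)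

end Ideal

/-! ### §2. Congruence `≡ 1 (mod N)` is an open condition; `K_δ(N)` is open and closed -/

section Level

variable {n : Type} [Fintype n] [DecidableEq n]

/-- **`{A ∈ M_n(𝔸_{ℚ,f}) | A ≡ 1 (mod N·𝓞̂)}` is open** (`N ≠ 0`; finitely many entry conditions, each the preimage of
the open `N·𝓞̂` under the continuous `A ↦ (A - 1)ᵢⱼ`). [cite: Deligne1971TravauxShimura, Exemple 4.16 p. 150] -/
theorem isOpen_setOf_isCongOne {N : ℕ} (hN : N ≠ 0) : IsOpen {A : Matrix n n finAdeleQ | IsCongOne N A} := by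
  have h : {A : Matrix n n finAdeleQ | IsCongOne N A} =
      ⋂ i, ⋂ j, (fun A : Matrix n n finAdeleQ => (A - 1) i j) ⁻¹' (levelIdeal N : Set finAdeleQ) := by
    ext A
    simp only [IsCongOne, Set.mem_setOf_eq, Set.mem_iInter, Set.mem_preimage, SetLike.mem_coe]
  rw [h]
  exact isOpen_iInter_of_finite fun i => isOpen_iInter_of_finite fun j =>
    (isOpen_levelIdeal hN).preimage ((continuous_id.sub continuous_const).matrix_elem i j)

variable (δ : Fin g → ℕ)

/-- **The principal level `K_δ(N)` is OPEN in `GSp_δ(𝔸_{ℚ,f})` for `N ≠ 0`** (subspace topology from Mathlib's units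
topology on `GL_{2g}(𝔸_{ℚ,f})`, in which `γ ↦ γ` and `γ ↦ γ⁻¹` are continuous matrix-valued maps).
[cite: Deligne1971TravauxShimura, Exemple 4.16 p. 150] [cite: PlatonovRapinchuk1994, Ch. 5 §5.1] -/
theorem isOpen_principalLevelSubgroup {N : ℕ} (hN : N ≠ 0) :
    IsOpen (principalLevelSubgroup δ N : Set (gspFinAdelic δ)) := by
  have hval : Continuous fun γ : gspFinAdelic δ =>
      ((γ : GL (Fin g ⊕ Fin g) finAdeleQ) : Matrix (Fin g ⊕ Fin g) (Fin g ⊕ Fin g) finAdeleQ) :=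
    Units.continuous_val.comp continuous_subtype_val
  have hinv : Continuous fun γ : gspFinAdelic δ =>
      (((γ : GL (Fin g ⊕ Fin g) finAdeleQ)⁻¹ : GL (Fin g ⊕ Fin g) finAdeleQ) :
        Matrix (Fin g ⊕ Fin g) (Fin g ⊕ Fin g) finAdeleQ) :=
    Units.continuous_coe_inv.comp continuous_subtype_val
  exact ((isOpen_setOf_isCongOne hN).preimage hval).inter ((isOpen_setOf_isCongOne hN).preimage hinv)

/-- `K_δ(N)` is closed in `GSp_δ(𝔸_{ℚ,f})` for `N ≠ 0` (an open subgroup is closed). [cite: PlatonovRapinchuk1994, Ch. 5 §5.1] -/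
theorem isClosed_principalLevelSubgroup {N : ℕ} (hN : N ≠ 0) :
    IsClosed (principalLevelSubgroup δ N : Set (gspFinAdelic δ)) :=
  Subgroup.isClosed_of_isOpen _ (isOpen_principalLevelSubgroup δ hN)

end Level

end Literature.AlgebraicGeometry.ModuliOfAbelianVarieties

end
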